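import Summits.QuantumAdvantage.QuantumAdvantage.Theorems.CharDialGammaDialC

/-!
# CharDialGammaDialD — TREE PART D of the decomp-qadv lens-5 g32 node «GammaDial» on `CharDial.FrobStructureLawOdd`
# (stmt-QuantumAdvantage-27205): §6 ★ SECTOR `γ = 2` of the γ-dial, `tabLawAt_two : p ≠ 2 → ∀ L, TabLawAt p 2 (p − 2) L`.
# Pair rows `{a_x, b_x}`; the discriminant `(a_x − b_x)²` is an AFFINE function `C₀ + Σ_{k ∈ x} δ_k` on the free cube that never
# vanishes; CAUCHY–DAVENPORT ON THE CUBE (`cube_subsetSums_card`: subset sums of nonzero steps take `≥ min(p, |T|+1)` values)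
# bounds `#{k : δ_k ≠ 0} ≤ p − 2`; `δ_k = 0` makes `k` a unit shift (part C), so `R ∪ {δ = 0}` is exchangeable.

Verbatim `section SectorTwo` of the node file (namespace `Theorems.GammaDial`); no definitions, no instances, no notation, no `sorry`.
-/

set_option autoImplicit false
set_option linter.dupNamespace false

namespace Summit.QuantumAdvantage.QuantumAdvantage.Theorems.GammaDial

open Finset
open Summit.QuantumAdvantage.AdviceFreeQNC0
open Literature.Computability.MetaComplexity Literature.Computability.MetaComplexity.Smolensky
open Summit.QuantumAdvantage.QuantumAdvantage.Theorems.IslandDial (Relevant Exch TopConst NormalForm ExchCoreAt ExchCoreOdd IslandAt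
  IslandOdd exchCoreOdd_of_target islandOdd_of_target exch_weight_form)
open Summit.QuantumAdvantage.QuantumAdvantage.Theorems.TableDial (TabLaw TabAt TabOdd tabLaw_all_of_core tabAt_iff_all tabOdd_of_target)
open Summit.QuantumAdvantage.QuantumAdvantage.Theorems.StrataDial (SwapInv exchCoreAt_iff_tabAt chi chi_slice chi_eq_zero_of_card
  chi_eq_zero_of_not_subset comp_swap_eq_self)

/-! ### §6 Sector `γ = 2`: pair rows, the discriminant is affine on the free cube and never zero — Cauchy–Davenport
bounds the non-shifting coordinates by `p − 2` -/

section SectorTwo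

variable {p : ℕ} [hp : Fact p.Prime] {n : ℕ}

/-- `2·C(w, 2) = w² − w` in any `𝔽_p`. -/
theorem two_mul_choose_two_cast (w : ℕ) : (2 : ZMod p) * ((w.choose 2 : ℕ) : ZMod p) = (w : ZMod p) ^ 2 - w := by
  induction w with
  | zero => simp
  | succ w ih =>
    have h : (w + 1).choose 2 = w.choose 1 + w.choose 2 := Nat.choose_succ_succ' w 1
    rw [h, Nat.choose_one_right]
    push_cast
    linear_combination ih

/-- A nonempty subset of `𝔽_p` closed under translation by `δ ≠ 0` is all of `𝔽_p`. -/
theorem eq_univ_of_translate_closed {A : Finset (ZMod p)} (hne : A.Nonempty) {δ : ZMod p} (hδ : δ ≠ 0)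
    (hcl : ∀ z ∈ A, z + δ ∈ A) : A = Finset.univ := by
  haveI : NeZero p := ⟨hp.out.ne_zero⟩
  obtain ⟨z₀, hz₀⟩ := hne
  have hm : ∀ m : ℕ, z₀ + (m : ZMod p) * δ ∈ A := by
    intro m
    induction m with
    | zero => simpa using hz₀
    | succ m ih =>
      have := hcl _ ih
      push_cast
      convert this using 1
      ring
  refine Finset.eq_univ_of_forall fun t => ?_
  have e : t = z₀ + ((((t - z₀) * δ⁻¹).val : ℕ) : ZMod p) * δ := by
    rw [ZMod.natCast_zmod_val, mul_assoc, inv_mul_cancel₀ hδ, mul_one]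
    ring
  rw [e]
  exact hm _

/-- **CAUCHY–DAVENPORT ON THE CUBE.** The subset sums `c + Σ_{k ∈ U} δ_k` (`U ⊆ T`) of NONZERO steps `δ_k` take at
least `min(p, |T| + 1)` values in `𝔽_p`. -/
theorem cube_subsetSums_card (δ : Fin n → ZMod p) (c : ZMod p) :
    ∀ T : Finset (Fin n), (∀ k ∈ T, δ k ≠ 0) → min p (T.card + 1) ≤ (T.powerset.image fun U => c + ∑ k ∈ U, δ k).card := by
  classical
  intro T
  induction T using Finset.induction_on with
  | empty =>
    intro _
    rw [Finset.powerset_empty, Finset.image_singleton, Finset.sum_empty, Finset.card_singleton, Finset.card_empty]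
    exact min_le_right _ _
  | insert a T haT ih =>
    intro hδ
    have hδa : δ a ≠ 0 := hδ a (Finset.mem_insert_self a T)
    have ih' := ih fun k hk => hδ k (Finset.mem_insert_of_mem hk)
    have hsplit : ((insert a T).powerset.image fun U => c + ∑ k ∈ U, δ k) =
        (T.powerset.image fun U => c + ∑ k ∈ U, δ k) ∪ (T.powerset.image fun U => c + ∑ k ∈ U, δ k).image (· + δ a) := by
      rw [Finset.powerset_insert, Finset.image_union, Finset.image_image, Finset.image_image]
      congr 1
      refine Finset.image_congr fun U hU => ?_
      have haU : a ∉ U := fun h => haT (Finset.mem_powerset.1 hU h)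
      show c + ∑ k ∈ insert a U, δ k = c + ∑ k ∈ U, δ k + δ a
      rw [Finset.sum_insert haU]
      ring
    rw [hsplit, Finset.card_insert_of_notMem haT]
    have hcA : c ∈ (T.powerset.image fun U => c + ∑ k ∈ U, δ k) :=
      Finset.mem_image.2 ⟨∅, Finset.empty_mem_powerset _, by rw [Finset.sum_empty, add_zero]⟩
    by_cases hsub : (T.powerset.image fun U => c + ∑ k ∈ U, δ k).image (· + δ a) ⊆ (T.powerset.image fun U => c + ∑ k ∈ U, δ k)
    · have hA := eq_univ_of_translate_closed ⟨c, hcA⟩ hδa fun z hz => hsub (Finset.mem_image_of_mem _ hz)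
      rw [Finset.union_eq_left.2 hsub, hA, Finset.card_univ, ZMod.card]
      exact min_le_left _ _
    · obtain ⟨y, hy, hyA⟩ := Finset.not_subset.1 hsub
      have h1 : (T.powerset.image fun U => c + ∑ k ∈ U, δ k).card + 1 ≤
          ((T.powerset.image fun U => c + ∑ k ∈ U, δ k) ∪ (T.powerset.image fun U => c + ∑ k ∈ U, δ k).image (· + δ a)).card := by
        rw [← Finset.card_insert_of_notMem hyA]
        exact Finset.card_le_card (Finset.insert_subset (Finset.mem_union_right _ hy) Finset.subset_union_left)
      omega

/-- Corollary: if no subset sum vanishes, there are at most `p − 2` nonzero steps. -/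
theorem card_add_two_le_of_subsetSums_ne_zero {T : Finset (Fin n)} (δ : Fin n → ZMod p) (hδ : ∀ k ∈ T, δ k ≠ 0)
    (c : ZMod p) (hne : ∀ U ⊆ T, c + ∑ k ∈ U, δ k ≠ 0) : T.card + 2 ≤ p := by
  classical
  have h1 := cube_subsetSums_card δ c T hδ
  have hsub : (T.powerset.image fun U => c + ∑ k ∈ U, δ k) ⊆ Finset.univ.erase 0 := by
    intro z hz
    obtain ⟨U, hU, rfl⟩ := Finset.mem_image.1 hz
    exact Finset.mem_erase.2 ⟨hne U (Finset.mem_powerset.1 hU), Finset.mem_univ _⟩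
  have h2 := Finset.card_le_card hsub
  rw [Finset.card_erase_of_mem (Finset.mem_univ _), Finset.card_univ, ZMod.card] at h2
  have := hp.out.two_le
  omega

/-- The free ones of a vertex `1_U` of the free cube are `U`. -/
theorem onesZ_vert {X R U : Finset (Fin n)} (hU : U ⊆ X \ R) : onesZ X R (SubLog.vert U) = U := by
  ext j
  rw [mem_onesZ]
  unfold SubLog.vert
  simp only [decide_eq_true_eq]
  constructor
  · rintro ⟨-, h⟩
    exact h
  · intro h
    exact ⟨Finset.mem_sdiff.1 (hU h), h⟩

/-- **SECTOR γ = 2** (every odd prime, every `L`, at most `p − 2` exceptions).  Every row is a pair `{a_x, b_x}`; the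
strata `p − 2`, `p − 3` make the discriminant `D(x) = (a_x − b_x)²` an AFFINE function `C₀ + Σ_{k ∈ x} δ_k` on the
free cube, never zero; Cauchy–Davenport on the cube bounds `#{k : δ_k ≠ 0} ≤ p − 2`, and `δ_k = 0` makes `k` a unit
shift (same discriminant, sum lowered by `2` ⟹ the pair moved down by one). -/
theorem tabLawAt_two (p : ℕ) [hp : Fact p.Prime] (hp2 : p ≠ 2) (L : ℕ) : TabLawAt p 2 (p - 2) L := by
  classical
  intro n f X R hRX hR hXR hdep hf htop hex
  have hp3 : 3 ≤ p := by have := hp.out.two_le; omega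
  obtain ⟨H, hH⟩ := exch_weight_form p f R hf hR hex
  obtain ⟨S, hSR, hSc⟩ : ∃ S ⊆ R, S.card = p - 2 := Finset.exists_subset_card_eq (by omega)
  obtain ⟨S', hS'R, hS'c⟩ : ∃ S' ⊆ R, S'.card = p - 3 := Finset.exists_subset_card_eq (by omega)
  have hRne : R.Nonempty := Finset.card_pos.1 (by omega)
  have hcnt : ∀ x, SubChar.resCount (H (JLin.proj (Finset.univ \ R) x)) = 2 := resCount_row hp2 hRX hR hdep hf htop hH
  -- (i) row sums are affine in the free weight
  have hM : ∀ x, mom1 (H (JLin.proj (Finset.univ \ R) x)) = -2 - chi p f S - 2 * ((onesZ X R x).card : ZMod p) := by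
    intro x
    have e1 := mom1_row hp2 hRX hdep hf htop hH hSR hSc x
    rw [hcnt] at e1
    linear_combination -e1
  -- (ii) the discriminant `D = 2·mom2 − mom1²` is affine on the free cube
  have hD : ∀ x, 2 * mom2 (H (JLin.proj (Finset.univ \ R) x)) - mom1 (H (JLin.proj (Finset.univ \ R) x)) ^ 2 =
      (4 * chi p f S' + 2 * chi p f S - chi p f S ^ 2) + ∑ k ∈ onesZ X R x, 4 * (chi p f (S' ∪ {k}) - chi p f S) := by
    intro x
    have e2 := mom2_row hp2 hRX hdep hf htop hH hS'R hS'c x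
    rw [hcnt, hM] at e2
    have hN : mom2 (H (JLin.proj (Finset.univ \ R) x)) = 2 * (chi p f S' + ∑ k ∈ onesZ X R x, chi p f (S' ∪ {k}) +
        (((onesZ X R x).card.choose 2 : ℕ) : ZMod p) * 2) - 3 * (-2 - chi p f S - 2 * ((onesZ X R x).card : ZMod p)) - 2 * 2 := by
      linear_combination e2
    have hsum : ∑ k ∈ onesZ X R x, 4 * (chi p f (S' ∪ {k}) - chi p f S) =
        4 * ∑ k ∈ onesZ X R x, chi p f (S' ∪ {k}) - 4 * chi p f S * ((onesZ X R x).card : ZMod p) := by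
      simp only [mul_sub, Finset.sum_sub_distrib, Finset.sum_const, nsmul_eq_mul, Finset.mul_sum]
      ring
    rw [hN, hM, hsum]
    linear_combination (4 : ZMod p) * two_mul_choose_two_cast (p := p) (onesZ X R x).card
  -- (iii) rows are pairs; the discriminant is `(a − b)² ≠ 0`
  have hpair : ∀ x, ∃ a b : ZMod p, a ≠ b ∧ (∀ s, H (JLin.proj (Finset.univ \ R) x) s = true ↔ s = a ∨ s = b) ∧
      mom1 (H (JLin.proj (Finset.univ \ R) x)) = a + b ∧ mom2 (H (JLin.proj (Finset.univ \ R) x)) = a ^ 2 + b ^ 2 :=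
    fun x => row_pair hp2 (hcnt x)
  have hDsq : ∀ x (a b : ZMod p), mom1 (H (JLin.proj (Finset.univ \ R) x)) = a + b →
      mom2 (H (JLin.proj (Finset.univ \ R) x)) = a ^ 2 + b ^ 2 →
      2 * mom2 (H (JLin.proj (Finset.univ \ R) x)) - mom1 (H (JLin.proj (Finset.univ \ R) x)) ^ 2 = (a - b) ^ 2 := by
    intro x a b h1 h2
    rw [h1, h2]
    ring
  have hD0 : ∀ x, 2 * mom2 (H (JLin.proj (Finset.univ \ R) x)) - mom1 (H (JLin.proj (Finset.univ \ R) x)) ^ 2 ≠ 0 := by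
    intro x
    obtain ⟨a, b, hab, -, h1, h2⟩ := hpair x
    rw [hDsq x a b h1 h2]
    exact pow_ne_zero 2 (sub_ne_zero.2 hab)
  -- (iv) the coordinates with nonzero step are few (Cauchy–Davenport on the free cube)
  have hBd : ((X \ R).filter fun k => 4 * (chi p f (S' ∪ {k}) - chi p f S) ≠ 0).card + 2 ≤ p := by
    refine card_add_two_le_of_subsetSums_ne_zero (fun k => 4 * (chi p f (S' ∪ {k}) - chi p f S))
      (fun k hk => (Finset.mem_filter.1 hk).2) (4 * chi p f S' + 2 * chi p f S - chi p f S ^ 2) fun U hU => ?_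
    have hUZ : U ⊆ X \ R := hU.trans (Finset.filter_subset _ _)
    rw [← onesZ_vert hUZ, ← hD]
    exact hD0 _
  -- (v) the coordinates with zero step are unit shifts
  have hshift : ∀ k ∈ (X \ R) \ ((X \ R).filter fun k => 4 * (chi p f (S' ∪ {k}) - chi p f S) ≠ 0), UnitShift R H k := by
    intro k hk x hxk s
    have hkZ : k ∈ X \ R := (Finset.mem_sdiff.1 hk).1
    have hδk : 4 * (chi p f (S' ∪ {k}) - chi p f S) = 0 := by
      by_contra h
      exact (Finset.mem_sdiff.1 hk).2 (Finset.mem_filter.2 ⟨hkZ, h⟩)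
    obtain ⟨a, b, hab, hs, h1, h2⟩ := hpair x
    obtain ⟨a', b', hab', hs', h1', h2'⟩ := hpair (Function.update x k true)
    have hsum : a' + b' = a + b - 2 := by
      rw [← h1, ← h1', hM, hM, card_onesZ_update_true hkZ hxk]
      push_cast
      ring
    have hdisc : (a' - b') ^ 2 = (a - b) ^ 2 := by
      have e := hD (Function.update x k true)
      have hk' : k ∉ onesZ X R x := by rw [mem_onesZ, hxk]; simp
      rw [onesZ_update_true hkZ hxk, Finset.sum_insert hk', hδk, zero_add, ← hD x, hDsq _ a' b' h1' h2',
        hDsq x a b h1 h2] at e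
      exact e
    rw [Bool.eq_iff_iff, hs', hs]
    exact pair_shift hp2 hsum hdisc s
  -- (vi) assemble: `Y = R ∪ (good free coordinates)`
  set Bd := (X \ R).filter fun k => 4 * (chi p f (S' ∪ {k}) - chi p f S) ≠ 0
  refine ⟨R ∪ ((X \ R) \ Bd), Finset.union_subset hRX (Finset.sdiff_subset.trans Finset.sdiff_subset), ?_,
    exch_union_of_unitShifts hH hex hRne fun k hk => ⟨(Finset.mem_sdiff.1 (Finset.mem_sdiff.1 hk).1).2, hshift k hk⟩⟩
  have hcov : X ⊆ (R ∪ ((X \ R) \ Bd)) ∪ Bd := by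
    intro j hj
    by_cases hjR : j ∈ R
    · exact Finset.mem_union_left _ (Finset.mem_union_left _ hjR)
    by_cases hjB : j ∈ Bd
    · exact Finset.mem_union_right _ hjB
    · exact Finset.mem_union_left _ (Finset.mem_union_right _ (Finset.mem_sdiff.2 ⟨Finset.mem_sdiff.2 ⟨hj, hjR⟩, hjB⟩))
  have := (Finset.card_le_card hcov).trans (Finset.card_union_le _ _)
  omega

end SectorTwo

end Summit.QuantumAdvantage.QuantumAdvantage.Theorems.GammaDial
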